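import Mathlib
import Literature.NumberTheory.LFunctions.Zhang2022.Section17Eq177HeadMoments
import Literature.NumberTheory.LFunctions.Zhang2022.Section17Eq177Shift
import Literature.NumberTheory.LFunctions.Zhang2022.Section7Eq73Edge
import HarnessLib

/-!
# Zhang (2022) §17 (17.7), the `Ψ₁ → Ψ` extension on `𝔍(−1)`, head part: "we move the path of
# integration to `𝔍(0)`" and the Hölder bound there — `Σ_{ψ∈Ψ₂}‖(1/2πi)∫_{𝔍(−1)} head_ψ ω‖ = o(𝔓)`

Topic `Literature/NumberTheory/LFunctions/Zhang2022` (Landau–Siegel audit tree; verdict-neutral).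
Y. Zhang, *Discrete mean estimates and the Landau–Siegel zero*, arXiv:2211.02515v1 (2022)
[Zhang2022LandauSiegel] — **an unrefereed manuscript under adjudication; nothing here asserts or
denies its Theorems 1–2, and no claim about Landau–Siegel zeros is made.** ZHANG-L discharge lane,
WP16 (seat zl-w16-p7, owner of (17.7) `Typed.Section17.Eq17_7`).

§17 p. 97 (tex L4785), the extension "extend the sum over `Ψ₁` to the sum over `Ψ`" of (17.7), HEAD
part (split of record, STATUS 2026-08-27 01:34Z): with
`head_ψ(s) = (Σ_{n≤⌊P²⌋}ϱ*_≤(n)ψ̄(n)n^{−(1−s)})·B(s,ψ)G(s,ψ)N(s+β₂,ψ)N(s+β₃,ψ)·ω(s)` (entire in `s`),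

* `sum_PsiTwo_norm_segInt_head_zero_le` — on `𝔍(0)`: `Σ_{ψ∈Ψ₂}‖(1/2πi)∫_{𝔍(0)}head_ψ‖ ≤ (C₇₄/2π)K𝔓𝓛⁻¹⁵`
  (the Hölder core `Eq177.core177` pointwise in `Im s`, `∫_{𝔍(0)}|ω||ds| ≪ 1` = (7.4),
  `Section7aStatements.eq74_holds`; twin of `Eq172.sum_PsiTwo_norm_segInt_head_le`);
* `norm_segInt_head_shift_le` — per `ψ ∈ Ψ`: `‖(1/2πi)∫_{𝔍(−1)}head_ψ − (1/2πi)∫_{𝔍(0)}head_ψ‖ ≤ (1/π)·M_D`,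
  Cauchy's theorem on `[−½, ½] × [2πt₀ ∓ 𝓛₁]` (`Section7aStatements.norm_intJ_sub_intJ_le`) with the
  horizontal-side bound `M_D = ⌊P²⌋(1+log⌊P²⌋)⁴ · K_ι(P+1)⁴D¹²(P+1)⁴ · 6e^{−𝓛¹⁰/4}`
  (`Eq177.norm_Bpoly/Gpoly/Nchar_le_left`, `Step8u016.omega_edge_le`);
* `shift_const_le_inv` — `(1/π)M_D ≤ c/D` once `𝓛 ≥ 49` (`P¹²e^{−𝓛¹⁰/4} ≤ e^{−𝓛}`);
* `sum_PsiTwo_norm_segInt_head_le` — **the head half of the extension**: for every `ε > 0`,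
  eventually and under (A), `Σ_{ψ∈Ψ₂}‖(1/2πi)∫_{𝔍(−1)}head_ψ‖ ≤ ε𝔓` (`#Ψ₂ ≤ 𝔓`,
  `Section7Eq73Edge.card_finsetOf_PsiTwo_le_frakP`).

The TAIL half (`𝔨₃*ω − head_ψ` on `𝔍(−1)`, holomorphic on `σ < 0`, moved to `𝔍(−𝓛⁹)`) is the sibling
seat's file (zl-w14-p4, twin of `Typed.Section15A.U009.tail`); the two halves compose to the `hext`
input of `Eq177.eq17_7_of_ext`. Theorems only; no definitions; standard axioms.
WHAT THIS IS NOT: (17.7) itself, the tail, or any claim about Theorems 1–2 of the source.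

## References

* Y. Zhang, arXiv:2211.02515v1 (2022), §17 (17.7) p. 97; §7 p. 35 (tex L1893, "we move the path of
  integration to `𝔍(0)`"), (7.4); §2 (2.15). [cite: Zhang2022LandauSiegel, §17 (17.7) p. 97]
-/

noncomputable section

open Finset Complex Real MeasureTheory intervalIntegral ComplexConjugate
open Literature.NumberTheory.LFunctions.Zhang2022.Skeleton
open Literature.NumberTheory.LFunctions.Zhang2022.Typed.Section17
open Literature.NumberTheory.LFunctions.Zhang2022.MeanSquareMajorant
open scoped LSeries.notation

namespace Literature.NumberTheory.LFunctions.Zhang2022.Eq177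

/-- An eventual statement may assume `D ≥ D₁`. [cite: Zhang2022LandauSiegel, §2 p. 4] -/
private theorem forAllLarge_ge' (D₁ : ℕ) : ForAllLarge fun D _ _ => D₁ ≤ D :=
  ForAllLarge.of_le D₁ fun _ _ _ hD _ _ => hD

/-! ## The head polynomial: size and holomorphy -/

section HeadPoly

variable (c' : ℝ) {D : ℕ} (χ : DirichletCharacter ℂ D)

/-- **`|Σ_{n≤X}ϱ*_≤(n)ψ̄(n)n^{−(1−s)}| ≤ X(1 + log X)⁴`** for `Re s ≤ 1` (`X = ⌊P²⌋`; `|ϱ*_≤| ≤ τ₄`,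
`|n^{−(1−s)}| ≤ 1`, `Σ_{n≤X}τ₄(n)/n ≤ (1+log X)⁴`). [cite: Zhang2022LandauSiegel, §17 (17.7) p.97] -/
theorem norm_headQ_le (x : Chr D) {s : ℂ} (hs : s.re ≤ 1) :
    ‖(∑ n ∈ Icc 1 ⌊bigP D ^ 2⌋₊, (LSeries.convolution (trunc (D ^ 4) (nu χ)) (kappa2bar c' D)) n * conj (x.ψ (n : ZMod x.p)) * (n : ℂ) ^ (-(1 - s)))‖ ≤ (⌊bigP D ^ 2⌋₊ : ℝ) * (1 + Real.log ⌊bigP D ^ 2⌋₊) ^ 4 := by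
  set X : ℕ := ⌊bigP D ^ 2⌋₊ with hXdef
  have hterm : ∀ n ∈ Icc 1 X, ‖(LSeries.convolution (trunc (D ^ 4) (nu χ)) (kappa2bar c' D)) n *
      conj (x.ψ (n : ZMod x.p)) * (n : ℂ) ^ (-(1 - s))‖ ≤ (X : ℝ) * (tau 4 n / n) := by
    intro n hn
    obtain ⟨h1, h2⟩ := Finset.mem_Icc.mp hn
    have hn0 : (0 : ℝ) < n := by exact_mod_cast h1
    have hnX : (n : ℝ) ≤ X := by exact_mod_cast h2
    rw [norm_mul, norm_mul]
    have hρ : ‖(LSeries.convolution (trunc (D ^ 4) (nu χ)) (kappa2bar c' D)) n‖ ≤ tau 4 n :=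
      norm_varrhoLe_le_tau c' χ n
    have hψ : ‖conj (x.ψ (n : ZMod x.p))‖ ≤ 1 := by rw [Complex.norm_conj]; exact x.ψ.norm_le_one _
    have hc : ‖(n : ℂ) ^ (-(1 - s))‖ ≤ 1 := by
      rw [Complex.norm_natCast_cpow_of_pos h1]
      refine Real.rpow_le_one_of_one_le_of_nonpos (by exact_mod_cast h1) ?_
      simp only [Complex.neg_re, Complex.sub_re, Complex.one_re]; linarith
    have hτ0 : 0 ≤ tau 4 n := tau_nonneg _ _
    calc ‖(LSeries.convolution (trunc (D ^ 4) (nu χ)) (kappa2bar c' D)) n‖ *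
          ‖conj (x.ψ (n : ZMod x.p))‖ * ‖(n : ℂ) ^ (-(1 - s))‖ ≤ tau 4 n * 1 * 1 := by
          gcongr
      _ = (n : ℝ) * (tau 4 n / n) := by field_simp
      _ ≤ (X : ℝ) * (tau 4 n / n) := mul_le_mul_of_nonneg_right hnX (div_nonneg hτ0 hn0.le)
  calc ‖(∑ n ∈ Icc 1 ⌊bigP D ^ 2⌋₊, (LSeries.convolution (trunc (D ^ 4) (nu χ)) (kappa2bar c' D)) n * conj (x.ψ (n : ZMod x.p)) * (n : ℂ) ^ (-(1 - s)))‖ ≤ ∑ n ∈ Icc 1 X, ‖(LSeries.convolution (trunc (D ^ 4) (nu χ)) (kappa2bar c' D)) n *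
          conj (x.ψ (n : ZMod x.p)) * (n : ℂ) ^ (-(1 - s))‖ := norm_sum_le _ _
    _ ≤ ∑ n ∈ Icc 1 X, (X : ℝ) * (tau 4 n / n) := Finset.sum_le_sum hterm
    _ = (X : ℝ) * ∑ n ∈ Icc 1 X, tau 4 n / n := by rw [Finset.mul_sum]
    _ ≤ (X : ℝ) * (1 + Real.log X) ^ 4 :=
        mul_le_mul_of_nonneg_left (sum_tau_div_Icc_le_log_pow 4 X) (Nat.cast_nonneg _)

/-- The head polynomial `s ↦ Σ_{n≤X}ϱ*_≤(n)ψ̄(n)n^{−(1−s)}` is entire. [cite: Zhang2022LandauSiegel, §17 (17.7) p.97] -/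
theorem differentiable_headQ (x : Chr D) :
    Differentiable ℂ fun s : ℂ => (∑ n ∈ Icc 1 ⌊bigP D ^ 2⌋₊, (LSeries.convolution (trunc (D ^ 4) (nu χ)) (kappa2bar c' D)) n * conj (x.ψ (n : ZMod x.p)) * (n : ℂ) ^ (-(1 - s))) := by
  refine Differentiable.fun_sum fun n hn => ?_
  have hn0 : (n : ℂ) ≠ 0 := Nat.cast_ne_zero.mpr (by have := (Finset.mem_Icc.mp hn).1; omega)
  exact (((differentiable_id.const_sub (1 : ℂ)).neg.const_cpow (Or.inl hn0)).const_mul _)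

/-- The head integrand `head_ψ` is entire. [cite: Zhang2022LandauSiegel, §17 (17.7) p.97] -/
theorem differentiable_headInt [NeZero D] (x : Chr D) :
    Differentiable ℂ (fun s =>
        (∑ n ∈ Icc 1 ⌊bigP D ^ 2⌋₊, (LSeries.convolution (trunc (D ^ 4) (nu χ)) (kappa2bar c' D)) n * conj (x.ψ (n : ZMod x.p)) * (n : ℂ) ^ (-(1 - s))) *
          (Bpoly χ x s * Gpoly χ x s * Nchar D (psiFn x) (s + beta2 c' D) * Nchar D (psiFn x) (s + beta3 c' D)) * omegaW D s) := by
  have hQ := differentiable_headQ c' χ x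
  have hB := differentiable_Bpoly χ x
  have hG := differentiable_Gpoly χ x
  have hN2 : Differentiable ℂ fun s : ℂ => Nchar D (psiFn x) (s + beta2 c' D) :=
    (differentiable_Nchar (D := D) (psiFn x)).comp (differentiable_id.add_const _)
  have hN3 : Differentiable ℂ fun s : ℂ => Nchar D (psiFn x) (s + beta3 c' D) :=
    (differentiable_Nchar (D := D) (psiFn x)).comp (differentiable_id.add_const _)
  have hω := Section7aStatements.differentiable_omegaW D
  exact (hQ.mul (((hB.mul hG).mul hN2).mul hN3)).mul hω

end HeadPoly

/-! ## On `𝔍(0)`: the Hölder core integrated against `|ω|` -/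

section OnJZero

/-- **On `𝔍(0)` the head integrals are small over `Ψ₂`**: with the constant `K` of `core177` and `C₇₄`
of (7.4), for all large `D` and under (A),
`Σ_{ψ∈Ψ₂}‖(1/2πi)∫_{𝔍(0)}head_ψ‖ ≤ (C₇₄/(2π))·K·𝔓·𝓛⁻¹⁵` (interchange of the finite sum with
`∫_{−𝓛₁}^{𝓛₁}dv`, `core177` pointwise in `v`, `∫|ω(s₀+iv)|dv ≤ C₇₄`).
[cite: Zhang2022LandauSiegel, §7 (7.4)–(7.5) pp.34–35; §17 (17.7) p.97] -/
theorem sum_PsiTwo_norm_segInt_head_zero_le (c' : ℝ) :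
    ∃ K : ℝ, ForAllLarge fun D _ χ => AssumptionA D χ →
      ∑ x ∈ finsetOf (PsiTwo χ),
        ‖Lemma81.segInt (t0 D) (ell1 D) 0 (fun s =>
        (∑ n ∈ Icc 1 ⌊bigP D ^ 2⌋₊, (LSeries.convolution (trunc (D ^ 4) (nu χ)) (kappa2bar c' D)) n * conj (x.ψ (n : ZMod x.p)) * (n : ℂ) ^ (-(1 - s))) *
          (Bpoly χ x s * Gpoly χ x s * Nchar D (psiFn x) (s + beta2 c' D) * Nchar D (psiFn x) (s + beta3 c' D)) * omegaW D s)‖ ≤ K * frakP D * (ell D ^ 15)⁻¹ := by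
  obtain ⟨K, hK⟩ := core177 c'
  obtain ⟨C₇₄, h74⟩ := Section7aStatements.eq74_holds
  refine ⟨C₇₄ / (2 * π) * max K 0, ?_⟩
  obtain ⟨D₃, hD₃⟩ := Section7Eq75.exists_nat_le_ell 3
  refine ((hK.and h74).and (forAllLarge_ge' D₃)).mono ?_
  intro D _ χ hq hp h hA
  obtain ⟨⟨hcore, h74D⟩, hD3⟩ := h
  have hℓ3 : 3 ≤ ell D := hD₃ D hD3
  have hℓ0 : 0 < ell D := by linarith
  have hℓ10 : 0 ≤ ell1 D := pow_nonneg hℓ0.le _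
  set Pf : ℝ := frakP D with hPf
  have hPf0 : 0 ≤ Pf := by
    rw [hPf, frakP_eq_sum_primeWindow]; exact sum_nonneg fun p _ => Nat.cast_nonneg p
  set X₀ : ℝ := max K 0 * Pf * (ell D ^ 15)⁻¹ with hX₀
  have hX₀0 : 0 ≤ X₀ := by positivity
  have hre : ∀ v : ℝ, ((0 : ℂ) + s0 D + v * I).re = 1 / 2 := by
    intro v; rw [s0, SmoothWeight.s0_def]; simp
  -- pointwise Hölder bound along the segment
  have hpt : ∀ v : ℝ, ∑ x ∈ finsetOf (PsiTwo χ), ‖(∑ n ∈ Icc 1 ⌊bigP D ^ 2⌋₊, (LSeries.convolution (trunc (D ^ 4) (nu χ)) (kappa2bar c' D)) n * conj (x.ψ (n : ZMod x.p)) * (n : ℂ) ^ (-(1 - ((0 : ℂ) + s0 D + v * I)))) *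
          (Bpoly χ x ((0 : ℂ) + s0 D + v * I) * Gpoly χ x ((0 : ℂ) + s0 D + v * I) * Nchar D (psiFn x) (((0 : ℂ) + s0 D + v * I) + beta2 c' D) * Nchar D (psiFn x) (((0 : ℂ) + s0 D + v * I) + beta3 c' D)) * omegaW D ((0 : ℂ) + s0 D + v * I)‖ ≤ X₀ * ‖omegaW D ((0 : ℂ) + s0 D + v * I)‖ := by
    intro v
    set s : ℂ := ((0 : ℂ) + s0 D + v * I) with hs
    have h := hcore hA s (hre v)
    calc ∑ x ∈ finsetOf (PsiTwo χ), ‖(∑ n ∈ Icc 1 ⌊bigP D ^ 2⌋₊, (LSeries.convolution (trunc (D ^ 4) (nu χ)) (kappa2bar c' D)) n * conj (x.ψ (n : ZMod x.p)) * (n : ℂ) ^ (-(1 - s))) *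
          (Bpoly χ x s * Gpoly χ x s * Nchar D (psiFn x) (s + beta2 c' D) * Nchar D (psiFn x) (s + beta3 c' D)) * omegaW D s‖
        = (∑ x ∈ finsetOf (PsiTwo χ), ‖(∑ n ∈ Icc 1 ⌊bigP D ^ 2⌋₊, (LSeries.convolution (trunc (D ^ 4) (nu χ)) (kappa2bar c' D)) n * conj (x.ψ (n : ZMod x.p)) * (n : ℂ) ^ (-(1 - s)))‖ *
            ‖Bpoly χ x s * Gpoly χ x s * Nchar D (psiFn x) (s + beta2 c' D) *
              Nchar D (psiFn x) (s + beta3 c' D)‖) * ‖omegaW D s‖ := by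
          rw [sum_mul]
          exact sum_congr rfl fun x _ => by rw [norm_mul, norm_mul]
      _ ≤ (K * Pf * (ell D ^ 15)⁻¹) * ‖omegaW D s‖ := mul_le_mul_of_nonneg_right h (norm_nonneg _)
      _ ≤ X₀ * ‖omegaW D s‖ := by
          apply mul_le_mul_of_nonneg_right _ (norm_nonneg _)
          rw [hX₀]; gcongr; exact le_max_left _ _
  -- each head integrand is continuous along the segment
  have hcont : ∀ x : Chr D, Continuous fun v : ℝ => (∑ n ∈ Icc 1 ⌊bigP D ^ 2⌋₊, (LSeries.convolution (trunc (D ^ 4) (nu χ)) (kappa2bar c' D)) n * conj (x.ψ (n : ZMod x.p)) * (n : ℂ) ^ (-(1 - ((0 : ℂ) + s0 D + v * I)))) *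
          (Bpoly χ x ((0 : ℂ) + s0 D + v * I) * Gpoly χ x ((0 : ℂ) + s0 D + v * I) * Nchar D (psiFn x) (((0 : ℂ) + s0 D + v * I) + beta2 c' D) * Nchar D (psiFn x) (((0 : ℂ) + s0 D + v * I) + beta3 c' D)) * omegaW D ((0 : ℂ) + s0 D + v * I) := by
    intro x
    have hline : Continuous fun v : ℝ => ((0 : ℂ) + s0 D + v * I) := by fun_prop
    exact (differentiable_headInt c' χ x).continuous.comp hline
  have h2π : ‖(1 / (2 * π) : ℂ)‖ = 1 / (2 * π) := by
    rw [norm_div, norm_one, norm_mul, Complex.norm_real, Real.norm_eq_abs, abs_of_pos Real.pi_pos]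
    norm_num
  have hper : ∀ x ∈ finsetOf (PsiTwo χ),
      ‖Lemma81.segInt (t0 D) (ell1 D) 0 (fun s =>
        (∑ n ∈ Icc 1 ⌊bigP D ^ 2⌋₊, (LSeries.convolution (trunc (D ^ 4) (nu χ)) (kappa2bar c' D)) n * conj (x.ψ (n : ZMod x.p)) * (n : ℂ) ^ (-(1 - s))) *
          (Bpoly χ x s * Gpoly χ x s * Nchar D (psiFn x) (s + beta2 c' D) * Nchar D (psiFn x) (s + beta3 c' D)) * omegaW D s)‖ ≤
        1 / (2 * π) * ∫ v in (-ell1 D)..ell1 D, ‖(∑ n ∈ Icc 1 ⌊bigP D ^ 2⌋₊, (LSeries.convolution (trunc (D ^ 4) (nu χ)) (kappa2bar c' D)) n * conj (x.ψ (n : ZMod x.p)) * (n : ℂ) ^ (-(1 - ((0 : ℂ) + s0 D + v * I)))) *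
          (Bpoly χ x ((0 : ℂ) + s0 D + v * I) * Gpoly χ x ((0 : ℂ) + s0 D + v * I) * Nchar D (psiFn x) (((0 : ℂ) + s0 D + v * I) + beta2 c' D) * Nchar D (psiFn x) (((0 : ℂ) + s0 D + v * I) + beta3 c' D)) * omegaW D ((0 : ℂ) + s0 D + v * I)‖ := by
    intro x _
    rw [Lemma81.segInt_def, norm_mul, h2π]
    refine mul_le_mul_of_nonneg_left ?_ (by positivity)
    exact intervalIntegral.norm_integral_le_integral_norm (by linarith)
  have hsum_int : ∑ x ∈ finsetOf (PsiTwo χ), ∫ v in (-ell1 D)..ell1 D, ‖(∑ n ∈ Icc 1 ⌊bigP D ^ 2⌋₊, (LSeries.convolution (trunc (D ^ 4) (nu χ)) (kappa2bar c' D)) n * conj (x.ψ (n : ZMod x.p)) * (n : ℂ) ^ (-(1 - ((0 : ℂ) + s0 D + v * I)))) *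
          (Bpoly χ x ((0 : ℂ) + s0 D + v * I) * Gpoly χ x ((0 : ℂ) + s0 D + v * I) * Nchar D (psiFn x) (((0 : ℂ) + s0 D + v * I) + beta2 c' D) * Nchar D (psiFn x) (((0 : ℂ) + s0 D + v * I) + beta3 c' D)) * omegaW D ((0 : ℂ) + s0 D + v * I)‖ =
      ∫ v in (-ell1 D)..ell1 D, ∑ x ∈ finsetOf (PsiTwo χ), ‖(∑ n ∈ Icc 1 ⌊bigP D ^ 2⌋₊, (LSeries.convolution (trunc (D ^ 4) (nu χ)) (kappa2bar c' D)) n * conj (x.ψ (n : ZMod x.p)) * (n : ℂ) ^ (-(1 - ((0 : ℂ) + s0 D + v * I)))) *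
          (Bpoly χ x ((0 : ℂ) + s0 D + v * I) * Gpoly χ x ((0 : ℂ) + s0 D + v * I) * Nchar D (psiFn x) (((0 : ℂ) + s0 D + v * I) + beta2 c' D) * Nchar D (psiFn x) (((0 : ℂ) + s0 D + v * I) + beta3 c' D)) * omegaW D ((0 : ℂ) + s0 D + v * I)‖ := by
    rw [intervalIntegral.integral_finsetSum]
    intro x _
    exact ((hcont x).norm).intervalIntegrable _ _
  have hωc : Continuous fun v : ℝ => ‖omegaW D ((0 : ℂ) + s0 D + v * I)‖ :=
    ((Section7aStatements.differentiable_omegaW D).continuous.comp (by fun_prop)).norm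
  have hint_le : ∫ v in (-ell1 D)..ell1 D, ∑ x ∈ finsetOf (PsiTwo χ), ‖(∑ n ∈ Icc 1 ⌊bigP D ^ 2⌋₊, (LSeries.convolution (trunc (D ^ 4) (nu χ)) (kappa2bar c' D)) n * conj (x.ψ (n : ZMod x.p)) * (n : ℂ) ^ (-(1 - ((0 : ℂ) + s0 D + v * I)))) *
          (Bpoly χ x ((0 : ℂ) + s0 D + v * I) * Gpoly χ x ((0 : ℂ) + s0 D + v * I) * Nchar D (psiFn x) (((0 : ℂ) + s0 D + v * I) + beta2 c' D) * Nchar D (psiFn x) (((0 : ℂ) + s0 D + v * I) + beta3 c' D)) * omegaW D ((0 : ℂ) + s0 D + v * I)‖ ≤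
      ∫ v in (-ell1 D)..ell1 D, X₀ * ‖omegaW D ((0 : ℂ) + s0 D + v * I)‖ := by
    refine intervalIntegral.integral_mono_on (by linarith) ?_ ?_ fun v _ => hpt v
    · exact (continuous_finsetSum _ fun x _ => (hcont x).norm).intervalIntegrable _ _
    · exact (hωc.const_mul _).intervalIntegrable _ _
  have h74' : ∫ v in (-ell1 D)..ell1 D, ‖omegaW D ((0 : ℂ) + s0 D + v * I)‖ ≤ C₇₄ := by
    have h := h74D 0 (by rw [abs_zero]; positivity)
    rw [Section7aStatements.absIntJ] at h
    simpa using h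
  calc ∑ x ∈ finsetOf (PsiTwo χ), ‖Lemma81.segInt (t0 D) (ell1 D) 0 (fun s =>
        (∑ n ∈ Icc 1 ⌊bigP D ^ 2⌋₊, (LSeries.convolution (trunc (D ^ 4) (nu χ)) (kappa2bar c' D)) n * conj (x.ψ (n : ZMod x.p)) * (n : ℂ) ^ (-(1 - s))) *
          (Bpoly χ x s * Gpoly χ x s * Nchar D (psiFn x) (s + beta2 c' D) * Nchar D (psiFn x) (s + beta3 c' D)) * omegaW D s)‖
      ≤ ∑ x ∈ finsetOf (PsiTwo χ), 1 / (2 * π) * ∫ v in (-ell1 D)..ell1 D, ‖(∑ n ∈ Icc 1 ⌊bigP D ^ 2⌋₊, (LSeries.convolution (trunc (D ^ 4) (nu χ)) (kappa2bar c' D)) n * conj (x.ψ (n : ZMod x.p)) * (n : ℂ) ^ (-(1 - ((0 : ℂ) + s0 D + v * I)))) *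
          (Bpoly χ x ((0 : ℂ) + s0 D + v * I) * Gpoly χ x ((0 : ℂ) + s0 D + v * I) * Nchar D (psiFn x) (((0 : ℂ) + s0 D + v * I) + beta2 c' D) * Nchar D (psiFn x) (((0 : ℂ) + s0 D + v * I) + beta3 c' D)) * omegaW D ((0 : ℂ) + s0 D + v * I)‖ :=
        sum_le_sum hper
    _ = 1 / (2 * π) * ∫ v in (-ell1 D)..ell1 D, ∑ x ∈ finsetOf (PsiTwo χ), ‖(∑ n ∈ Icc 1 ⌊bigP D ^ 2⌋₊, (LSeries.convolution (trunc (D ^ 4) (nu χ)) (kappa2bar c' D)) n * conj (x.ψ (n : ZMod x.p)) * (n : ℂ) ^ (-(1 - ((0 : ℂ) + s0 D + v * I)))) *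
          (Bpoly χ x ((0 : ℂ) + s0 D + v * I) * Gpoly χ x ((0 : ℂ) + s0 D + v * I) * Nchar D (psiFn x) (((0 : ℂ) + s0 D + v * I) + beta2 c' D) * Nchar D (psiFn x) (((0 : ℂ) + s0 D + v * I) + beta3 c' D)) * omegaW D ((0 : ℂ) + s0 D + v * I)‖ := by
        rw [← mul_sum, hsum_int]
    _ ≤ 1 / (2 * π) * ∫ v in (-ell1 D)..ell1 D, X₀ * ‖omegaW D ((0 : ℂ) + s0 D + v * I)‖ :=
        mul_le_mul_of_nonneg_left hint_le (by positivity)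
    _ = 1 / (2 * π) * (X₀ * ∫ v in (-ell1 D)..ell1 D, ‖omegaW D ((0 : ℂ) + s0 D + v * I)‖) := by
        rw [intervalIntegral.integral_const_mul]
    _ ≤ 1 / (2 * π) * (X₀ * C₇₄) := by gcongr
    _ = C₇₄ / (2 * π) * max K 0 * frakP D * (ell D ^ 15)⁻¹ := by rw [hX₀]; ring

end OnJZero

/-! ## The move `𝔍(−1) → 𝔍(0)` for the (entire) head integrand -/

section Shift

variable (c' : ℝ) {D : ℕ} [NeZero D] (χ : DirichletCharacter ℂ D)

/-- **"We move the path of integration to `𝔍(0)`"** (§7 p.35, tex L1893) for the head integrand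
`head_ψ`, which is entire: for `𝓛 ≥ 3`, every `ψ ∈ Ψ`,
`‖(1/2πi)∫_{𝔍(−1)}head_ψ − (1/2πi)∫_{𝔍(0)}head_ψ‖ ≤ (1/π)·M_D`, Cauchy's theorem on
`[−½, ½] × [2πt₀−𝓛₁, 2πt₀+𝓛₁]` (`Section7aStatements.norm_intJ_sub_intJ_le`); on the horizontal sides
`|head poly| ≤ ⌊P²⌋(1+log⌊P²⌋)⁴`, `|B| ≤ K_ι(P+1)⁴`, `|G| ≤ D¹²`, `|N| ≤ (P+1)²`, `|ω| ≤ 6e^{−𝓛¹⁰/4}`.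
[cite: Zhang2022LandauSiegel, §7 p.35, tex L1893; §17 (17.7) p.97] -/
theorem norm_segInt_head_shift_le (hℓ : 3 ≤ ell D) (x : Chr D) :
    ‖Lemma81.segInt (t0 D) (ell1 D) (-1) (fun s =>
        (∑ n ∈ Icc 1 ⌊bigP D ^ 2⌋₊, (LSeries.convolution (trunc (D ^ 4) (nu χ)) (kappa2bar c' D)) n * conj (x.ψ (n : ZMod x.p)) * (n : ℂ) ^ (-(1 - s))) *
          (Bpoly χ x s * Gpoly χ x s * Nchar D (psiFn x) (s + beta2 c' D) * Nchar D (psiFn x) (s + beta3 c' D)) * omegaW D s) -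
        Lemma81.segInt (t0 D) (ell1 D) 0 (fun s =>
        (∑ n ∈ Icc 1 ⌊bigP D ^ 2⌋₊, (LSeries.convolution (trunc (D ^ 4) (nu χ)) (kappa2bar c' D)) n * conj (x.ψ (n : ZMod x.p)) * (n : ℂ) ^ (-(1 - s))) *
          (Bpoly χ x s * Gpoly χ x s * Nchar D (psiFn x) (s + beta2 c' D) * Nchar D (psiFn x) (s + beta3 c' D)) * omegaW D s)‖ ≤
      (1 / π) * ((⌊bigP D ^ 2⌋₊ : ℝ) * (1 + Real.log ⌊bigP D ^ 2⌋₊) ^ 4 *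
        ((1 + ‖iota2‖) * (‖iota3‖ + ‖iota4‖) * (bigP D + 1) ^ 4 * (D : ℝ) ^ 12 *
          (bigP D + 1) ^ 2 * (bigP D + 1) ^ 2) * (6 * Real.exp (-(ell D ^ 10) / 4))) := by
  have hlog : 2 ≤ Real.log D := le_trans (by norm_num) hℓ
  have hℓ10 : 0 ≤ ell1 D := pow_nonneg (by linarith) _
  have hP0 : 0 ≤ bigP D + 1 := by have := Real.exp_pos (ell D ^ 9); rw [bigP]; linarith
  set G : ℂ → ℂ := (fun s =>
        (∑ n ∈ Icc 1 ⌊bigP D ^ 2⌋₊, (LSeries.convolution (trunc (D ^ 4) (nu χ)) (kappa2bar c' D)) n * conj (x.ψ (n : ZMod x.p)) * (n : ℂ) ^ (-(1 - s))) *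
          (Bpoly χ x s * Gpoly χ x s * Nchar D (psiFn x) (s + beta2 c' D) * Nchar D (psiFn x) (s + beta3 c' D)) * omegaW D s) with hG
  set A : ℝ := (⌊bigP D ^ 2⌋₊ : ℝ) * (1 + Real.log ⌊bigP D ^ 2⌋₊) ^ 4 with hA
  set Bc : ℝ := (1 + ‖iota2‖) * (‖iota3‖ + ‖iota4‖) * (bigP D + 1) ^ 4 * (D : ℝ) ^ 12 *
    (bigP D + 1) ^ 2 * (bigP D + 1) ^ 2 with hBc
  set Mval : ℝ := A * Bc * (6 * Real.exp (-(ell D ^ 10) / 4)) with hMval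
  have hA0 : 0 ≤ A := by
    rw [hA]; exact mul_nonneg (Nat.cast_nonneg _) (pow_nonneg (by
      have := Real.log_natCast_nonneg ⌊bigP D ^ 2⌋₊; linarith) _)
  have hPge : 0 ≤ bigP D := (Real.exp_pos _).le
  have hBc0 : 0 ≤ Bc := by rw [hBc]; positivity
  have hMval0 : 0 ≤ Mval := by rw [hMval]; positivity
  -- holomorphy on the rectangle (everywhere)
  have hGd : Differentiable ℂ G := differentiable_headInt c' χ x
  have hGon : DifferentiableOn ℂ G (Set.uIcc (1 / 2 + (-1 : ℝ)) (1 / 2 + 0) ×ℂ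
      Set.uIcc (2 * π * t0 D - ell1 D) (2 * π * t0 D + ell1 D)) := hGd.differentiableOn
  -- the horizontal sides
  have hside : ∀ t : ℝ, (t = 2 * π * t0 D + ell1 D ∨ t = 2 * π * t0 D - ell1 D) →
      ∀ u ∈ Set.Icc (1 / 2 + (-1 : ℝ)) (1 / 2 + 0), ‖G ((u : ℂ) + ((t : ℝ) : ℂ) * I)‖ ≤ Mval := by
    intro t ht u hu
    obtain ⟨hu1, hu2⟩ := hu
    set s : ℂ := (u : ℂ) + ((t : ℝ) : ℂ) * I with hs
    have hsre : s.re = u := by simp [hs]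
    obtain ⟨hb2, hb3⟩ := Eq172.re_add_beta23 c' (D := D) s
    have h1 : ‖(∑ n ∈ Icc 1 ⌊bigP D ^ 2⌋₊, (LSeries.convolution (trunc (D ^ 4) (nu χ)) (kappa2bar c' D)) n * conj (x.ψ (n : ZMod x.p)) * (n : ℂ) ^ (-(1 - s)))‖ ≤ A := norm_headQ_le c' χ x (by rw [hsre]; linarith)
    have hB : ‖Bpoly χ x s‖ ≤ (1 + ‖iota2‖) * (‖iota3‖ + ‖iota4‖) * (bigP D + 1) ^ 4 :=
      norm_Bpoly_le_left χ x hlog (by rw [hsre]; linarith)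
    have hGp : ‖Gpoly χ x s‖ ≤ (D : ℝ) ^ 12 := norm_Gpoly_le_left χ x (by rw [hsre]; linarith)
    have hN2 : ‖Nchar D (psiFn x) (s + beta2 c' D)‖ ≤ (bigP D + 1) ^ 2 :=
      norm_Nchar_le_left x hℓ (by rw [hb2, hsre]; linarith)
    have hN3 : ‖Nchar D (psiFn x) (s + beta3 c' D)‖ ≤ (bigP D + 1) ^ 2 :=
      norm_Nchar_le_left x hℓ (by rw [hb3, hsre]; linarith)
    have h2 : ‖Bpoly χ x s * Gpoly χ x s * Nchar D (psiFn x) (s + beta2 c' D) *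
        Nchar D (psiFn x) (s + beta3 c' D)‖ ≤ Bc := by
      rw [norm_mul, norm_mul, norm_mul, hBc]
      have e1 := mul_le_mul hB hGp (norm_nonneg _) (mul_nonneg Eq172.Kiota_nonneg (pow_nonneg hP0 _))
      have e2 := mul_le_mul e1 hN2 (norm_nonneg _)
        (mul_nonneg (mul_nonneg Eq172.Kiota_nonneg (pow_nonneg hP0 _)) (pow_nonneg (Nat.cast_nonneg _) _))
      exact mul_le_mul e2 hN3 (norm_nonneg _) (mul_nonneg (mul_nonneg (mul_nonneg Eq172.Kiota_nonneg
        (pow_nonneg hP0 _)) (pow_nonneg (Nat.cast_nonneg _) _)) (pow_nonneg hP0 _))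
    have h3 : ‖omegaW D s‖ ≤ 6 * Real.exp (-(ell D ^ 10) / 4) := by
      have hs' : s = ((u - 1 / 2 : ℝ) : ℂ) + SmoothWeight.s0 (t0 D) + ((t - 2 * π * t0 D : ℝ) : ℂ) * I := by
        rw [hs, SmoothWeight.s0_def]; push_cast; ring
      have hℓ2 : 0 < ell2 D := pow_pos (by linarith) _
      rw [omegaW, hs', SmoothWeight.norm_omega_segment_eq hℓ2]
      have hsq : (t - 2 * π * t0 D) ^ 2 = ell1 D ^ 2 := by
        rcases ht with ht' | ht' <;> rw [ht'] <;> ring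
      rw [hsq]
      have hz : (u - 1 / 2) ^ 2 ≤ 1 := by
        rw [sq_le_one_iff_abs_le_one, abs_le]; constructor <;> linarith
      exact Step8u016.omega_edge_le hℓ (z := u - 1 / 2) hz
    calc ‖G s‖ = ‖(∑ n ∈ Icc 1 ⌊bigP D ^ 2⌋₊, (LSeries.convolution (trunc (D ^ 4) (nu χ)) (kappa2bar c' D)) n * conj (x.ψ (n : ZMod x.p)) * (n : ℂ) ^ (-(1 - s)))‖ * ‖Bpoly χ x s * Gpoly χ x s * Nchar D (psiFn x) (s + beta2 c' D) *
          Nchar D (psiFn x) (s + beta3 c' D)‖ * ‖omegaW D s‖ := by rw [hG]; simp only [norm_mul]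
      _ ≤ A * Bc * (6 * Real.exp (-(ell D ^ 10) / 4)) := by
          have e1 := mul_le_mul h1 h2 (norm_nonneg _) hA0
          exact mul_le_mul e1 h3 (norm_nonneg _) (mul_nonneg hA0 hBc0)
  have hmove := Section7aStatements.norm_intJ_sub_intJ_le D (z₁ := -1) (z₂ := 0) (M₁ := Mval)
    (M₂ := Mval) (by norm_num) hGon (hside _ (Or.inl rfl)) (hside _ (Or.inr rfl))
  -- `segInt (−1) − segInt 0 = (intJ (−1) − intJ 0)/(2πi)`
  have hI : Lemma81.segInt (t0 D) (ell1 D) (-1) G - Lemma81.segInt (t0 D) (ell1 D) 0 G =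
      (Section7aStatements.intJ D (-1) G - Section7aStatements.intJ D 0 G) / (2 * π * I) := by
    rw [show (-1 : ℂ) = ((-1 : ℝ) : ℂ) by norm_num, show (0 : ℂ) = ((0 : ℝ) : ℂ) by norm_num,
      Step8u016.segInt_eq_intJ_div, Step8u016.segInt_eq_intJ_div, sub_div]
  have hnorm2 : ‖(2 : ℂ) * π * I‖ = 2 * π := by
    rw [norm_mul, norm_mul, Complex.norm_I, mul_one, Complex.norm_real, Real.norm_eq_abs,
      abs_of_pos Real.pi_pos]
    norm_num
  rw [hI, norm_div, hnorm2, div_le_iff₀ (by positivity), norm_sub_rev]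
  calc ‖Section7aStatements.intJ D 0 G - Section7aStatements.intJ D (-1) G‖
      ≤ (0 - (-1)) * (Mval + Mval) := hmove
    _ = 1 / π * Mval * (2 * π) := by field_simp; ring

omit [NeZero D] χ in
/-- **The per-character shift constant is `≪ 1/D`**: for `𝓛 ≥ 49` (and `D ≥ 3`),
`(1/π)·⌊P²⌋(1+log⌊P²⌋)⁴·K_ι(P+1)⁴D¹²(P+1)⁴·6e^{−𝓛¹⁰/4} ≤ (6·81·256·K_ι/π)·D⁻¹`
(`⌊P²⌋ ≤ P²`, `(1+log⌊P²⌋)⁴ ≤ 81𝓛³⁶ ≤ 81P`, `P+1 ≤ 2P`, `D¹² ≤ P`, and `P¹²e^{−𝓛¹⁰/4} ≤ e^{−𝓛} = D⁻¹`).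
[cite: Zhang2022LandauSiegel, §17 (17.7) p.97; §2 (2.6)] -/
theorem shift_const_le_inv (hD3 : 3 ≤ D) (hℓ : 49 ≤ ell D) :
    (1 / π) * ((⌊bigP D ^ 2⌋₊ : ℝ) * (1 + Real.log ⌊bigP D ^ 2⌋₊) ^ 4 *
        ((1 + ‖iota2‖) * (‖iota3‖ + ‖iota4‖) * (bigP D + 1) ^ 4 * (D : ℝ) ^ 12 *
          (bigP D + 1) ^ 2 * (bigP D + 1) ^ 2) * (6 * Real.exp (-(ell D ^ 10) / 4))) ≤
      (6 * 81 * 256 * ((1 + ‖iota2‖) * (‖iota3‖ + ‖iota4‖)) / π) * (D : ℝ)⁻¹ := by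
  set K : ℝ := (1 + ‖iota2‖) * (‖iota3‖ + ‖iota4‖) with hK
  have hK0 : 0 ≤ K := Eq172.Kiota_nonneg
  have hℓ1 : 1 ≤ ell D := by linarith
  have hℓ0 : 0 < ell D := by linarith
  have hD0 : (0 : ℝ) < D := by exact_mod_cast lt_of_lt_of_le (by norm_num) hD3
  have hDexp : (D : ℝ) = Real.exp (ell D) := by rw [ell, Real.exp_log hD0]
  set P : ℝ := bigP D with hPdef
  have hPexp : P = Real.exp (ell D ^ 9) := by rw [hPdef, bigP]
  have hP1 : 1 ≤ P := by rw [hPexp]; exact Real.one_le_exp (by positivity)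
  have hP0 : 0 < P := by linarith
  -- the elementary sizes
  obtain ⟨hX2, hlogX⟩ := Typed.Sec14.Eq143.floor_bigP_sq_facts hℓ1
  have hXle : (⌊bigP D ^ 2⌋₊ : ℝ) ≤ P ^ 2 := Nat.floor_le (by positivity)
  have hlogX0 : 0 ≤ Real.log (⌊bigP D ^ 2⌋₊ : ℝ) := Real.log_natCast_nonneg _
  -- `ℓ⁹ ≤ ... `: `36 ℓ ≤ ℓ⁹` and `12 ℓ ≤ ℓ⁹`
  have hℓ8 : (49 : ℝ) ^ 8 ≤ ell D ^ 8 := pow_le_pow_left₀ (by norm_num) hℓ 8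
  have hℓ8' : (36 : ℝ) ≤ ell D ^ 8 := le_trans (by norm_num) hℓ8
  have h36 : 36 * ell D ≤ ell D ^ 9 := by
    calc 36 * ell D ≤ ell D ^ 8 * ell D := mul_le_mul_of_nonneg_right hℓ8' hℓ0.le
      _ = ell D ^ 9 := by ring
  have h12 : 12 * ell D ≤ ell D ^ 9 := by linarith
  -- `(1 + log X)^4 ≤ 81 P`
  have hlog4 : (1 + Real.log (⌊bigP D ^ 2⌋₊ : ℝ)) ^ 4 ≤ 81 * P := by
    have h1 : 1 + Real.log (⌊bigP D ^ 2⌋₊ : ℝ) ≤ 3 * ell D ^ 9 := by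
      have : (1 : ℝ) ≤ ell D ^ 9 := one_le_pow₀ hℓ1
      linarith
    have h2 : (1 + Real.log (⌊bigP D ^ 2⌋₊ : ℝ)) ^ 4 ≤ (3 * ell D ^ 9) ^ 4 :=
      pow_le_pow_left₀ (by linarith) h1 4
    have h3 : (ell D ^ 9) ^ 4 ≤ P := by
      -- `ℓ³⁶ ≤ e^{36ℓ} ≤ e^{ℓ⁹}`
      have ha : ell D ≤ Real.exp (ell D) := by linarith [Real.add_one_le_exp (ell D)]
      calc (ell D ^ 9) ^ 4 = ell D ^ 36 := by ring
        _ ≤ Real.exp (ell D) ^ 36 := pow_le_pow_left₀ hℓ0.le ha 36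
        _ = Real.exp (36 * ell D) := by rw [← Real.exp_nat_mul]; norm_num
        _ ≤ P := by rw [hPexp]; exact Real.exp_le_exp.mpr h36
    calc (1 + Real.log (⌊bigP D ^ 2⌋₊ : ℝ)) ^ 4 ≤ (3 * ell D ^ 9) ^ 4 := h2
      _ = 81 * (ell D ^ 9) ^ 4 := by ring
      _ ≤ 81 * P := by linarith
  have hD12 : (D : ℝ) ^ 12 ≤ P := by
    rw [hDexp, ← Real.exp_nat_mul, hPexp, Real.exp_le_exp]
    have : ((12 : ℕ) : ℝ) * ell D = 12 * ell D := by norm_num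
    rw [this]; exact h12
  have hP1' : P + 1 ≤ 2 * P := by linarith
  -- the product of the polynomial sizes is `≤ 81·256·K·P¹²`
  have hpoly : (⌊bigP D ^ 2⌋₊ : ℝ) * (1 + Real.log ⌊bigP D ^ 2⌋₊) ^ 4 *
      (K * (P + 1) ^ 4 * (D : ℝ) ^ 12 * (P + 1) ^ 2 * (P + 1) ^ 2) ≤
      81 * 256 * K * P ^ 12 := by
    have e4 : (P + 1) ^ 4 ≤ (2 * P) ^ 4 := pow_le_pow_left₀ (by linarith) hP1' 4
    have e2 : (P + 1) ^ 2 ≤ (2 * P) ^ 2 := pow_le_pow_left₀ (by linarith) hP1' 2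
    calc (⌊bigP D ^ 2⌋₊ : ℝ) * (1 + Real.log ⌊bigP D ^ 2⌋₊) ^ 4 *
          (K * (P + 1) ^ 4 * (D : ℝ) ^ 12 * (P + 1) ^ 2 * (P + 1) ^ 2)
        ≤ P ^ 2 * (81 * P) * (K * (2 * P) ^ 4 * P * (2 * P) ^ 2 * (2 * P) ^ 2) := by
          gcongr
      _ = 81 * 256 * K * P ^ 12 := by ring
  -- `P¹² e^{−ℓ¹⁰/4} ≤ e^{−ℓ} = D⁻¹`
  have hexp : P ^ 12 * Real.exp (-(ell D ^ 10) / 4) ≤ (D : ℝ)⁻¹ := by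
    rw [hPexp, ← Real.exp_nat_mul, ← Real.exp_add, hDexp, ← Real.exp_neg, Real.exp_le_exp]
    have h10 : ell D ^ 10 = ell D ^ 9 * ell D := by ring
    rw [h10]
    have h9pos : 0 < ell D ^ 9 := pow_pos hℓ0 9
    have f1 : ell D ^ 9 * 49 ≤ ell D ^ 9 * ell D := mul_le_mul_of_nonneg_left hℓ h9pos.le
    have f2 : 4 * ell D ≤ ell D ^ 9 := by linarith
    push_cast
    linarith
  calc 1 / π * ((⌊bigP D ^ 2⌋₊ : ℝ) * (1 + Real.log ⌊bigP D ^ 2⌋₊) ^ 4 *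
        (K * (P + 1) ^ 4 * (D : ℝ) ^ 12 * (P + 1) ^ 2 * (P + 1) ^ 2) *
          (6 * Real.exp (-(ell D ^ 10) / 4)))
      = 6 / π * ((⌊bigP D ^ 2⌋₊ : ℝ) * (1 + Real.log ⌊bigP D ^ 2⌋₊) ^ 4 *
          (K * (P + 1) ^ 4 * (D : ℝ) ^ 12 * (P + 1) ^ 2 * (P + 1) ^ 2)) *
            Real.exp (-(ell D ^ 10) / 4) := by ring
    _ ≤ 6 / π * (81 * 256 * K * P ^ 12) * Real.exp (-(ell D ^ 10) / 4) := by
        gcongr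
    _ = 6 * 81 * 256 * K / π * (P ^ 12 * Real.exp (-(ell D ^ 10) / 4)) := by ring
    _ ≤ 6 * 81 * 256 * K / π * (D : ℝ)⁻¹ := mul_le_mul_of_nonneg_left hexp (by positivity)

end Shift

/-! ## The head half of the extension -/

section Head

/-- **The head half of the `Ψ₁ → Ψ` extension of (17.7)**: for every `ε > 0`, for all large `D` and
every real primitive `χ (mod D)` with (A),
`Σ_{ψ∈Ψ₂} ‖(1/2πi)∫_{𝔍(−1)} head_ψ(s) ds‖ ≤ ε𝔓` — per character the move to `𝔍(0)` costs `≪ D⁻¹`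
(`norm_segInt_head_shift_le`, `shift_const_le_inv`; summed over `#Ψ₂ ≤ 𝔓`), and on `𝔍(0)` the
Hölder core gives `≪ 𝔓𝓛⁻¹⁵` (`sum_PsiTwo_norm_segInt_head_zero_le`).
[cite: Zhang2022LandauSiegel, §17 (17.7) p.97; §7 (7.5) p.35] -/
theorem sum_PsiTwo_norm_segInt_head_le (c' : ℝ) :
    ∀ ε : ℝ, 0 < ε → ForAllLarge fun D _ χ => AssumptionA D χ →
      ∑ x ∈ finsetOf (PsiTwo χ),
        ‖Lemma81.segInt (t0 D) (ell1 D) (-1) (fun s =>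
        (∑ n ∈ Icc 1 ⌊bigP D ^ 2⌋₊, (LSeries.convolution (trunc (D ^ 4) (nu χ)) (kappa2bar c' D)) n * conj (x.ψ (n : ZMod x.p)) * (n : ℂ) ^ (-(1 - s))) *
          (Bpoly χ x s * Gpoly χ x s * Nchar D (psiFn x) (s + beta2 c' D) * Nchar D (psiFn x) (s + beta3 c' D)) * omegaW D s)‖ ≤ ε * frakP D := by
  intro ε hε
  have hε2 : 0 < ε / 2 := by positivity
  obtain ⟨K, hK⟩ := sum_PsiTwo_norm_segInt_head_zero_le c'
  set Kι : ℝ := (1 + ‖iota2‖) * (‖iota3‖ + ‖iota4‖) with hKι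
  have hKι0 : 0 ≤ Kι := Eq172.Kiota_nonneg
  set c₀ : ℝ := 6 * 81 * 256 * Kι / π with hc₀
  have hc₀0 : 0 ≤ c₀ := by rw [hc₀]; positivity
  obtain ⟨Dℓ, hDℓ⟩ := Section7Eq75.exists_nat_le_ell (max 49 ((2 * max K 0 / ε) + 1))
  refine (hK.and (forAllLarge_ge' (max (max Dℓ 3) ⌈2 * c₀ / ε⌉₊))).mono ?_
  intro D _ χ hq hp h hA
  obtain ⟨hzero, hD⟩ := h
  simp only [max_le_iff] at hD
  obtain ⟨⟨hDℓ', hD3⟩, hDc⟩ := hD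
  have hℓmax := hDℓ D hDℓ'
  have hℓ49 : 49 ≤ ell D := le_trans (le_max_left _ _) hℓmax
  have hℓK : 2 * max K 0 / ε + 1 ≤ ell D := le_trans (le_max_right _ _) hℓmax
  have hℓ3 : 3 ≤ ell D := by linarith
  have hℓ1 : 1 ≤ ell D := by linarith
  have hℓ0 : 0 < ell D := by linarith
  have hD0 : (0 : ℝ) < D := by exact_mod_cast lt_of_lt_of_le (by norm_num) hD3
  set Pf : ℝ := frakP D with hPf
  have hPf0 : 0 ≤ Pf := by
    rw [hPf, frakP_eq_sum_primeWindow]; exact sum_nonneg fun p _ => Nat.cast_nonneg p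
  -- per-character shift constant `≤ c₀/D ≤ ε/2`
  set η : ℝ := (1 / π) * ((⌊bigP D ^ 2⌋₊ : ℝ) * (1 + Real.log ⌊bigP D ^ 2⌋₊) ^ 4 *
    (Kι * (bigP D + 1) ^ 4 * (D : ℝ) ^ 12 * (bigP D + 1) ^ 2 * (bigP D + 1) ^ 2) *
      (6 * Real.exp (-(ell D ^ 10) / 4))) with hη
  have hηle : η ≤ ε / 2 := by
    have h1 : η ≤ c₀ * (D : ℝ)⁻¹ := by rw [hη, hc₀, hKι]; exact shift_const_le_inv hD3 hℓ49
    have h2 : c₀ * (D : ℝ)⁻¹ ≤ ε / 2 := by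
      have hDc' : 2 * c₀ / ε ≤ D := le_trans (Nat.le_ceil _) (by exact_mod_cast hDc)
      rw [← div_eq_mul_inv, div_le_iff₀ hD0]
      have := mul_le_mul_of_nonneg_left hDc' hε2.le
      calc c₀ = ε / 2 * (2 * c₀ / ε) := by field_simp
        _ ≤ ε / 2 * D := this
    exact h1.trans h2
  -- per character: ‖segInt (−1) head‖ ≤ η + ‖segInt 0 head‖
  have hper : ∀ x : Chr D,
      ‖Lemma81.segInt (t0 D) (ell1 D) (-1) (fun s =>
        (∑ n ∈ Icc 1 ⌊bigP D ^ 2⌋₊, (LSeries.convolution (trunc (D ^ 4) (nu χ)) (kappa2bar c' D)) n * conj (x.ψ (n : ZMod x.p)) * (n : ℂ) ^ (-(1 - s))) *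
          (Bpoly χ x s * Gpoly χ x s * Nchar D (psiFn x) (s + beta2 c' D) * Nchar D (psiFn x) (s + beta3 c' D)) * omegaW D s)‖ ≤
        η + ‖Lemma81.segInt (t0 D) (ell1 D) 0 (fun s =>
        (∑ n ∈ Icc 1 ⌊bigP D ^ 2⌋₊, (LSeries.convolution (trunc (D ^ 4) (nu χ)) (kappa2bar c' D)) n * conj (x.ψ (n : ZMod x.p)) * (n : ℂ) ^ (-(1 - s))) *
          (Bpoly χ x s * Gpoly χ x s * Nchar D (psiFn x) (s + beta2 c' D) * Nchar D (psiFn x) (s + beta3 c' D)) * omegaW D s)‖ := by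
    intro x
    have h2 := norm_segInt_head_shift_le c' χ hℓ3 x
    set J1 := Lemma81.segInt (t0 D) (ell1 D) (-1) (fun s =>
        (∑ n ∈ Icc 1 ⌊bigP D ^ 2⌋₊, (LSeries.convolution (trunc (D ^ 4) (nu χ)) (kappa2bar c' D)) n * conj (x.ψ (n : ZMod x.p)) * (n : ℂ) ^ (-(1 - s))) *
          (Bpoly χ x s * Gpoly χ x s * Nchar D (psiFn x) (s + beta2 c' D) * Nchar D (psiFn x) (s + beta3 c' D)) * omegaW D s) with hJ1
    set J0 := Lemma81.segInt (t0 D) (ell1 D) 0 (fun s =>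
        (∑ n ∈ Icc 1 ⌊bigP D ^ 2⌋₊, (LSeries.convolution (trunc (D ^ 4) (nu χ)) (kappa2bar c' D)) n * conj (x.ψ (n : ZMod x.p)) * (n : ℂ) ^ (-(1 - s))) *
          (Bpoly χ x s * Gpoly χ x s * Nchar D (psiFn x) (s + beta2 c' D) * Nchar D (psiFn x) (s + beta3 c' D)) * omegaW D s) with hJ0
    calc ‖J1‖ = ‖(J1 - J0) + J0‖ := by ring_nf
      _ ≤ ‖J1 - J0‖ + ‖J0‖ := norm_add_le _ _
      _ ≤ η + ‖J0‖ := add_le_add h2 le_rfl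
  have hcard : ((finsetOf (PsiTwo χ)).card : ℝ) ≤ Pf := Section7Eq73Edge.card_finsetOf_PsiTwo_le_frakP χ
  -- the `𝔍(0)` sum
  have hX : K * Pf * (ell D ^ 15)⁻¹ ≤ ε / 2 * Pf := by
    have h15 : ell D ≤ ell D ^ 15 := le_self_pow₀ hℓ1 (by norm_num)
    have hKℓ : K * (ell D ^ 15)⁻¹ ≤ ε / 2 := by
      have hpos : 0 < ell D ^ 15 := by positivity
      rw [← div_eq_mul_inv, div_le_iff₀ hpos]
      have : 2 * max K 0 / ε ≤ ell D ^ 15 := by linarith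
      have h' : 2 * max K 0 ≤ ε * ell D ^ 15 := by
        rw [div_le_iff₀ hε] at this; linarith
      calc K ≤ max K 0 := le_max_left _ _
        _ ≤ ε / 2 * ell D ^ 15 := by linarith
    calc K * Pf * (ell D ^ 15)⁻¹ = (K * (ell D ^ 15)⁻¹) * Pf := by ring
      _ ≤ ε / 2 * Pf := mul_le_mul_of_nonneg_right hKℓ hPf0
  have hη0 : 0 ≤ η := by
    rw [hη]
    have hP0 : 0 ≤ bigP D + 1 := by have := Real.exp_pos (ell D ^ 9); rw [bigP]; linarith
    have hl : 0 ≤ 1 + Real.log (⌊bigP D ^ 2⌋₊ : ℝ) := by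
      have := Real.log_natCast_nonneg ⌊bigP D ^ 2⌋₊; linarith
    positivity
  calc ∑ x ∈ finsetOf (PsiTwo χ), ‖Lemma81.segInt (t0 D) (ell1 D) (-1) (fun s =>
        (∑ n ∈ Icc 1 ⌊bigP D ^ 2⌋₊, (LSeries.convolution (trunc (D ^ 4) (nu χ)) (kappa2bar c' D)) n * conj (x.ψ (n : ZMod x.p)) * (n : ℂ) ^ (-(1 - s))) *
          (Bpoly χ x s * Gpoly χ x s * Nchar D (psiFn x) (s + beta2 c' D) * Nchar D (psiFn x) (s + beta3 c' D)) * omegaW D s)‖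
      ≤ ∑ x ∈ finsetOf (PsiTwo χ), (η + ‖Lemma81.segInt (t0 D) (ell1 D) 0 (fun s =>
        (∑ n ∈ Icc 1 ⌊bigP D ^ 2⌋₊, (LSeries.convolution (trunc (D ^ 4) (nu χ)) (kappa2bar c' D)) n * conj (x.ψ (n : ZMod x.p)) * (n : ℂ) ^ (-(1 - s))) *
          (Bpoly χ x s * Gpoly χ x s * Nchar D (psiFn x) (s + beta2 c' D) * Nchar D (psiFn x) (s + beta3 c' D)) * omegaW D s)‖) :=
        sum_le_sum fun x _ => hper x
    _ = (finsetOf (PsiTwo χ)).card * η +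
          ∑ x ∈ finsetOf (PsiTwo χ), ‖Lemma81.segInt (t0 D) (ell1 D) 0 (fun s =>
        (∑ n ∈ Icc 1 ⌊bigP D ^ 2⌋₊, (LSeries.convolution (trunc (D ^ 4) (nu χ)) (kappa2bar c' D)) n * conj (x.ψ (n : ZMod x.p)) * (n : ℂ) ^ (-(1 - s))) *
          (Bpoly χ x s * Gpoly χ x s * Nchar D (psiFn x) (s + beta2 c' D) * Nchar D (psiFn x) (s + beta3 c' D)) * omegaW D s)‖ := by
        rw [sum_add_distrib, sum_const, nsmul_eq_mul]
    _ ≤ Pf * (ε / 2) + K * Pf * (ell D ^ 15)⁻¹ :=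
        add_le_add (mul_le_mul hcard hηle hη0 hPf0) (hzero hA)
    _ ≤ Pf * (ε / 2) + ε / 2 * Pf := by linarith
    _ = ε * frakP D := by rw [hPf]; ring

end Head

end Literature.NumberTheory.LFunctions.Zhang2022.Eq177
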